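import Summits.KontsevichZagierPeriods.KontsevichZagierPeriods.Theorems.HyperbolicBlochOffTetraSectorKernelLadderFamilyExists
import Summits.KontsevichZagierPeriods.KontsevichZagierPeriods.Theorems.HyperbolicBlochFiveTermTransferStubFiveTermIndicator
import Literature.NumberTheory.Transcendental.KZSemiCanonicalReductionProofs
import Literature.NumberTheory.Transcendental.KZCalculusProofs
import Literature.NumberTheory.Transcendental.KZLogCalculusProofs

/-!
# Towards `stub_polytopeEnvelope`, the cusp partition — crux `OffTetraSectorKernel` (v5, lead c3)

Cutting off the balls of a separating radius `ρ` around finitely many floor points (rule (1a), sphere walls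
null): `polyEnv_cusp_partition`; a separating rational radius exists (`polyEnv_exists_radius`); the exterior of
such a ball is one more linear constraint in the lift (`polyEnv_exterior_row`); relations lie in the Bloch–Wigner
envelope (`polyEnv_relations_subset`).

References: M. Kontsevich, D. Zagier, *Periods* (2001), §1.2 rule (1).
-/

noncomputable section

open Set MeasureTheory
open Literature.NumberTheory.Transcendental Literature.ModelTheory.ExponentialFields

namespace Summit.KontsevichZagierPeriods.HyperbolicBloch.OffTetraSectorKernel

/-- Relations lie in the envelope (witness `k = 0`). [folklore] -/
theorem polyEnv_relations_subset (ρ₀ : ℂ → KZ.IntegralRep 3) {x : KZ.FormalRep} (hx : x ∈ KZ.relations) :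
    x ∈ AddSubgroup.closure {x : KZ.FormalRep | ∃ (k : ℕ) (z : Fin k → ℂ) (e : Fin k → ℤ),
      (∀ i, IsAlgebraic ℚ (z i)) ∧ (∀ i, 0 < (z i).im) ∧ x - ∑ i, e i • KZ.of (ρ₀ (z i)) ∈ KZ.relations} :=
  AddSubgroup.subset_closure ⟨0, Fin.elim0, Fin.elim0, fun i => i.elim0, fun i => i.elim0, by simpa using hx⟩

/-- Euclidean triangle inequality in the plane, squared form: two points of two balls of radius `ρ` whose centres
are `> 2ρ` apart cannot coincide. [folklore] -/
theorem polyEnv_balls_disjoint {n n' : Fin 2 → ℝ} {ρ : ℝ} (hρ : 0 < ρ)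
    (hsep : (2 * ρ) ^ 2 < (n 0 - n' 0) ^ 2 + (n 1 - n' 1) ^ 2) (p : Fin 3 → ℝ)
    (h1 : (p 0 - n 0) ^ 2 + (p 1 - n 1) ^ 2 + p 2 ^ 2 < ρ ^ 2)
    (h2 : (p 0 - n' 0) ^ 2 + (p 1 - n' 1) ^ 2 + p 2 ^ 2 < ρ ^ 2) : False := by
  have e : ∀ u v : ℝ, Real.sqrt (u ^ 2 + v ^ 2) = ‖(WithLp.equiv 2 (Fin 2 → ℝ)).symm ![u, v]‖ := by
    intro u v
    rw [EuclideanSpace.norm_eq, Fin.sum_univ_two]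
    simp [Real.norm_eq_abs, sq_abs]
  have hA : Real.sqrt ((p 0 - n 0) ^ 2 + (p 1 - n 1) ^ 2) < ρ := by
    rw [show ρ = Real.sqrt (ρ ^ 2) by rw [Real.sqrt_sq hρ.le]]
    exact Real.sqrt_lt_sqrt (by positivity) (by nlinarith [sq_nonneg (p 2)])
  have hB : Real.sqrt ((p 0 - n' 0) ^ 2 + (p 1 - n' 1) ^ 2) < ρ := by
    rw [show ρ = Real.sqrt (ρ ^ 2) by rw [Real.sqrt_sq hρ.le]]
    exact Real.sqrt_lt_sqrt (by positivity) (by nlinarith [sq_nonneg (p 2)])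
  have hM : Real.sqrt ((n 0 - n' 0) ^ 2 + (n 1 - n' 1) ^ 2) ≤
      Real.sqrt ((p 0 - n 0) ^ 2 + (p 1 - n 1) ^ 2) + Real.sqrt ((p 0 - n' 0) ^ 2 + (p 1 - n' 1) ^ 2) := by
    rw [e, e, e]
    have hsum : (WithLp.equiv 2 (Fin 2 → ℝ)).symm ![n 0 - n' 0, n 1 - n' 1] =
        -(WithLp.equiv 2 (Fin 2 → ℝ)).symm ![p 0 - n 0, p 1 - n 1] +
          (WithLp.equiv 2 (Fin 2 → ℝ)).symm ![p 0 - n' 0, p 1 - n' 1] := by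
      ext i
      fin_cases i <;> simp
    rw [hsum]
    exact (norm_add_le _ _).trans (by rw [norm_neg])
  have h2ρ : Real.sqrt ((n 0 - n' 0) ^ 2 + (n 1 - n' 1) ^ 2) < 2 * ρ := by linarith
  have h3 := (Real.sqrt_lt' (by positivity : 0 < 2 * ρ)).mp h2ρ
  linarith

/-! ### The cusp partition (rule (1a)) -/

/-- The boundary-centred ball of radius `ρ` around the floor point `n` is `ℚ`-semialgebraic for algebraic data,
and so is its exterior. [cite: BochnakCosteRoy1998, Prop. 2.2.6] -/
theorem polyEnv_isSemialgebraic_ball (n : Fin 2 → ℝ) (hn : ∀ l, IsAlgebraic ℚ (n l)) (ρ : ℝ)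
    (hρ : IsAlgebraic ℚ ρ) :
    IsSemialgebraic ℚ {p : Fin 3 → ℝ | (p 0 - n 0) ^ 2 + (p 1 - n 1) ^ 2 + p 2 ^ 2 < ρ ^ 2} ∧
    IsSemialgebraic ℚ {p : Fin 3 → ℝ | ρ ^ 2 < (p 0 - n 0) ^ 2 + (p 1 - n 1) ^ 2 + p 2 ^ 2} := by
  have hU : IsSemialgebraic ℚ (univ : Set (Fin 3 → ℝ)) := isSemialgebraic_univ
  have ha : ∀ l : Fin 3, IsAlgebraic ℚ ((![n 0, n 1, 0] : Fin 3 → ℝ) l) := by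
    intro l; fin_cases l
    · simpa using hn 0
    · simpa using hn 1
    · simpa using isAlgebraic_zero
  have hf := isSemialgebraicFunOn_sphere_of_isAlgebraic (m := 3) ha (hρ.pow 2)
  have h0 : IsSemialgebraicFunOn ℚ (univ : Set (Fin 3 → ℝ)) (fun _ => (0 : ℝ)) :=
    isSemialgebraicFunOn_const_of_isAlgebraic hU isAlgebraic_zero
  have e : ∀ p : Fin 3 → ℝ, (∑ l, (p l - (![n 0, n 1, 0] : Fin 3 → ℝ) l) ^ 2) - ρ ^ 2 =
      (p 0 - n 0) ^ 2 + (p 1 - n 1) ^ 2 + p 2 ^ 2 - ρ ^ 2 := fun p => by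
    simp [Fin.sum_univ_three]
  constructor
  · convert isSemialgebraic_setOf_lt_of_isSemialgebraicFunOn hf h0 using 1
    ext p
    simp only [mem_setOf_eq, e]
    constructor <;> intro h <;> linarith
  · convert isSemialgebraic_setOf_lt_of_isSemialgebraicFunOn h0 hf using 1
    ext p
    simp only [mem_setOf_eq, e]
    constructor <;> intro h <;> linarith

/-- The sphere of radius `ρ` centred at the floor point `(n, 0)` is Lebesgue-null. [folklore] -/
theorem polyEnv_volume_sphere (n : Fin 2 → ℝ) (ρ : ℝ) :
    volume {p : Fin 3 → ℝ | (p 0 - n 0) ^ 2 + (p 1 - n 1) ^ 2 + p 2 ^ 2 = ρ ^ 2} = 0 := by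
  have h := Summit.KontsevichZagierPeriods.HyperbolicBloch.FiveTerm.volume_quadric_eq_zero 1 (-2 * n 0) (-2 * n 1)
    (n 0 ^ 2 + n 1 ^ 2 - ρ ^ 2) (by norm_num)
  convert h using 2
  ext p
  simp only [mem_setOf_eq]
  constructor <;> intro h <;> linarith [h]

/-- **Cusp partition.** Cutting off the balls of radius `ρ` around finitely many floor points pairwise `> 2ρ` apart
is one iterated domain-additivity move: `[r] ≡ [r|rest] + Σₙ [r|ball n]` (the sphere walls are null).
[cite: KontsevichZagier2001, §1.2 rule (1)] -/
theorem polyEnv_cusp_partition : ∀ (r : KZ.IntegralRep 3) (CF : Finset (Fin 2 → ℝ)),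
    (∀ n ∈ CF, ∀ l, IsAlgebraic ℚ (n l)) → ∀ (ρ : ℝ), 0 < ρ → IsAlgebraic ℚ ρ →
    (∀ n ∈ CF, ∀ n' ∈ CF, n ≠ n' → (2 * ρ) ^ 2 < (n 0 - n' 0) ^ 2 + (n 1 - n' 1) ^ 2) →
    ∃ (rrest : KZ.IntegralRep 3) (rn : (Fin 2 → ℝ) → KZ.IntegralRep 3),
      rrest.domain = r.domain ∩ {p | ∀ n ∈ CF, ρ ^ 2 < (p 0 - n 0) ^ 2 + (p 1 - n 1) ^ 2 + p 2 ^ 2} ∧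
      rrest.integrand = r.integrand ∧
      (∀ n ∈ CF, (rn n).domain = r.domain ∩ {p | (p 0 - n 0) ^ 2 + (p 1 - n 1) ^ 2 + p 2 ^ 2 < ρ ^ 2} ∧
        (rn n).integrand = r.integrand) ∧
      KZ.of r - KZ.of rrest - ∑ n ∈ CF, KZ.of (rn n) ∈ KZ.relations := by
  intro r CF hCalg ρ hρ hρalg hsep
  classical
  -- the pieces
  have hsaB : ∀ n ∈ CF, IsSemialgebraic ℚ (r.domain ∩
      {p : Fin 3 → ℝ | (p 0 - n 0) ^ 2 + (p 1 - n 1) ^ 2 + p 2 ^ 2 < ρ ^ 2}) := fun n hn =>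
    r.isSemialgebraic_domain.inter (polyEnv_isSemialgebraic_ball n (hCalg n hn) ρ hρalg).1
  have hsaR : IsSemialgebraic ℚ (r.domain ∩
      {p : Fin 3 → ℝ | ∀ n ∈ CF, ρ ^ 2 < (p 0 - n 0) ^ 2 + (p 1 - n 1) ^ 2 + p 2 ^ 2}) := by
    have : {p : Fin 3 → ℝ | ∀ n ∈ CF, ρ ^ 2 < (p 0 - n 0) ^ 2 + (p 1 - n 1) ^ 2 + p 2 ^ 2} =
        ⋂ n ∈ CF, {p : Fin 3 → ℝ | ρ ^ 2 < (p 0 - n 0) ^ 2 + (p 1 - n 1) ^ 2 + p 2 ^ 2} := by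
      ext p; simp
    rw [this]
    exact r.isSemialgebraic_domain.inter (IsSemialgebraic.biInter CF _ fun n hn =>
      (polyEnv_isSemialgebraic_ball n (hCalg n hn) ρ hρalg).2)
  set rrest := r.restrict _ hsaR inter_subset_left with hrrest
  set rn : (Fin 2 → ℝ) → KZ.IntegralRep 3 := fun n =>
    if hn : n ∈ CF then r.restrict _ (hsaB n hn) inter_subset_left else r with hrn
  have hrn_dom : ∀ n ∈ CF, (rn n).domain = r.domain ∩
      {p | (p 0 - n 0) ^ 2 + (p 1 - n 1) ^ 2 + p 2 ^ 2 < ρ ^ 2} := fun n hn => by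
    simp [hrn, dif_pos hn]
  have hrn_int : ∀ n ∈ CF, (rn n).integrand = r.integrand := fun n hn => by
    simp [hrn, dif_pos hn]
  refine ⟨rrest, rn, rfl, rfl, fun n hn => ⟨hrn_dom n hn, hrn_int n hn⟩, ?_⟩
  -- iterated domain additivity over `Option`-indexed pieces
  set R : Option (Fin 2 → ℝ) → KZ.IntegralRep 3 := fun o => Option.elim o rrest rn with hR
  have hRsub : ∀ o ∈ Finset.insertNone CF, (R o).domain ⊆ r.domain := by
    intro o ho
    rcases o with _ | n
    · exact inter_subset_left
    · have hn : n ∈ CF := Finset.some_mem_insertNone.mp ho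
      show (rn n).domain ⊆ r.domain
      rw [hrn_dom n hn]
      exact inter_subset_left
  have key := KZ.of_sub_sum_of_mem_relations (Finset.insertNone CF) r R (fun o ho => ?_) (fun o ho => ?_) ?_ ?_
  · rw [Finset.sum_insertNone] at key
    simpa [hR, sub_sub] using key
  · -- domains inside `r.domain`
    rw [Set.sdiff_eq_empty.mpr (hRsub o ho), measure_empty]
  · rcases o with _ | n
    · intro p _; rfl
    · have hn : n ∈ CF := Finset.some_mem_insertNone.mp ho
      intro p _
      simp [hR, hrn_int n hn]
  · -- cover up to the sphere walls
    have hsub : r.domain \ ⋃ o ∈ Finset.insertNone CF, (R o).domain ⊆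
        ⋃ n ∈ CF, {p : Fin 3 → ℝ | (p 0 - n 0) ^ 2 + (p 1 - n 1) ^ 2 + p 2 ^ 2 = ρ ^ 2} := by
      intro p hp
      obtain ⟨hpr, hnot⟩ := hp
      simp only [mem_iUnion, not_exists, exists_prop, not_and] at hnot
      have h1 := hnot none (Finset.none_mem_insertNone)
      simp only [hR, Option.elim, hrrest, KZ.IntegralRep.domain_restrict, mem_inter_iff, mem_setOf_eq,
        not_and, not_forall, not_lt, exists_prop] at h1
      obtain ⟨n, hn, hle⟩ := h1 hpr
      have h2 := hnot (some n) (Finset.some_mem_insertNone.mpr hn)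
      simp only [hR, Option.elim, hrn_dom n hn, mem_inter_iff, mem_setOf_eq, not_and, not_lt] at h2
      have hge := h2 hpr
      exact mem_iUnion₂.mpr ⟨n, hn, le_antisymm hle hge⟩
    refine measure_mono_null hsub ?_
    exact (measure_biUnion_null_iff CF.countable_toSet).mpr fun n _ => polyEnv_volume_sphere n ρ
  · -- pairwise null (in fact empty) intersections
    intro o ho o' ho' hoo'
    have hempty : (R o).domain ∩ (R o').domain = ∅ := by
      rcases o with _ | n <;> rcases o' with _ | n'
      · exact absurd rfl hoo'
      · have hn' : n' ∈ CF := Finset.some_mem_insertNone.mp ho'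
        ext p
        simp only [hR, Option.elim, hrrest, KZ.IntegralRep.domain_restrict, hrn_dom n' hn', mem_inter_iff,
          mem_setOf_eq, mem_empty_iff_false, iff_false]
        rintro ⟨⟨-, hall⟩, -, hlt⟩
        linarith [hall n' hn']
      · have hn : n ∈ CF := Finset.some_mem_insertNone.mp ho
        ext p
        simp only [hR, Option.elim, hrrest, KZ.IntegralRep.domain_restrict, hrn_dom n hn, mem_inter_iff,
          mem_setOf_eq, mem_empty_iff_false, iff_false]
        rintro ⟨⟨-, hlt⟩, -, hall⟩
        linarith [hall n hn]
      · have hn : n ∈ CF := Finset.some_mem_insertNone.mp ho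
        have hn' : n' ∈ CF := Finset.some_mem_insertNone.mp ho'
        have hne : n ≠ n' := fun h => hoo' (by rw [h])
        ext p
        simp only [hR, Option.elim, hrn_dom n hn, hrn_dom n' hn', mem_inter_iff, mem_setOf_eq,
          mem_empty_iff_false, iff_false]
        rintro ⟨⟨-, h1⟩, -, h2⟩
        exact polyEnv_balls_disjoint hρ (hsep n hn n' hn' hne) p h1 h2
    rw [hempty, measure_empty]

/-! ### A separating radius and the registered stub -/

/-- A positive rational radius `ρ` such that the finitely many floor candidates are pairwise `> 2ρ` apart. [folklore] -/
theorem polyEnv_exists_radius (CF : Finset (Fin 2 → ℝ)) :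
    ∃ ρ : ℝ, 0 < ρ ∧ IsAlgebraic ℚ ρ ∧
      ∀ n ∈ CF, ∀ n' ∈ CF, n ≠ n' → (2 * ρ) ^ 2 < (n 0 - n' 0) ^ 2 + (n 1 - n' 1) ^ 2 := by
  classical
  by_cases hS : CF.offDiag = ∅
  · refine ⟨1, one_pos, isAlgebraic_one, fun n hn n' hn' hne => ?_⟩
    have : (n, n') ∈ CF.offDiag := Finset.mem_offDiag.mpr ⟨hn, hn', hne⟩
    rw [hS] at this
    exact absurd this (Finset.notMem_empty _)
  · have hne : CF.offDiag.Nonempty := Finset.nonempty_iff_ne_empty.mpr hS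
    set d : (Fin 2 → ℝ) × (Fin 2 → ℝ) → ℝ := fun ab => (ab.1 0 - ab.2 0) ^ 2 + (ab.1 1 - ab.2 1) ^ 2 with hd
    set D := CF.offDiag.inf' hne d with hD
    have hDpos : 0 < D := by
      rw [hD, Finset.lt_inf'_iff]
      rintro ⟨a, b⟩ hab
      obtain ⟨-, -, hne'⟩ := Finset.mem_offDiag.mp hab
      rw [hd]
      dsimp only
      by_contra hle
      push Not at hle
      apply hne'
      have h0 : (a 0 - b 0) ^ 2 = 0 := by nlinarith [sq_nonneg (a 0 - b 0), sq_nonneg (a 1 - b 1)]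
      have h1 : (a 1 - b 1) ^ 2 = 0 := by nlinarith [sq_nonneg (a 0 - b 0), sq_nonneg (a 1 - b 1)]
      ext i
      fin_cases i
      · exact sub_eq_zero.mp ((pow_eq_zero_iff two_ne_zero).mp h0)
      · exact sub_eq_zero.mp ((pow_eq_zero_iff two_ne_zero).mp h1)
    obtain ⟨q, hq0, hq1⟩ := exists_rat_btwn (lt_min one_pos (by positivity : (0 : ℝ) < D / 4))
    have hq1' : (q : ℝ) < 1 := hq1.trans_le (min_le_left _ _)
    have hqD : (q : ℝ) < D / 4 := hq1.trans_le (min_le_right _ _)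
    refine ⟨q, hq0, by simpa using isAlgebraic_algebraMap (R := ℚ) (A := ℝ) q, fun n hn n' hn' hne' => ?_⟩
    have hle : D ≤ d (n, n') := Finset.inf'_le d (Finset.mem_offDiag.mpr ⟨hn, hn', hne'⟩)
    rw [hd] at hle
    dsimp only at hle
    have hsq : (q : ℝ) ^ 2 < (q : ℝ) := by nlinarith
    nlinarith

/-- The exterior-of-ball row: `Σ_c (1, −2n₀, −2n₁, |n|² − ρ²)_c (Ql p)_c = |p − (n,0)|² − ρ²`. [folklore] -/
theorem polyEnv_exterior_row (Ql : (Fin 3 → ℝ) → Fin 4 → ℝ)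
    (hQl : ∀ p, Ql p = ![p 0 ^ 2 + p 1 ^ 2 + p 2 ^ 2, p 0, p 1, 1]) (n : Fin 2 → ℝ) (ρ : ℝ) (p : Fin 3 → ℝ) :
    ∑ c, (![1, -2 * n 0, -2 * n 1, n 0 ^ 2 + n 1 ^ 2 - ρ ^ 2] : Fin 4 → ℝ) c * Ql p c =
      (p 0 - n 0) ^ 2 + (p 1 - n 1) ^ 2 + p 2 ^ 2 - ρ ^ 2 := by
  simp only [hQl, Fin.sum_univ_four, Matrix.cons_val_zero, Matrix.cons_val_one, Matrix.cons_val_two,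
    Matrix.cons_val_three, Matrix.head_cons, Matrix.tail_cons]
  ring

end Summit.KontsevichZagierPeriods.HyperbolicBloch.OffTetraSectorKernel

end
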